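import Summits.QuantumFields.YangMills.Theorems.FluctuationComparisonRegPrIntLS2BetaChartReadDerivKStepSup
import Summits.QuantumFields.YangMills.Theorems.FluctuationComparisonRegPrIntLS2BetaChartReadDescentChainRule
import Literature.MathematicalPhysics.QuantumFieldTheory.Balaban1983to89.T3LevelShift
import HarnessLib

/-!
# S2β · (REG-UP)′ bridge (O2-b2) — «THE k-STEP SUP ROW FROM AN INTERMEDIATE LEVEL»: on a `T3Family` member `F.P K`, the chart-read iterate STARTING AT LEVEL `k₀`
# (`Ψ^{W}_{k₀,n} A c := Λ(Ū_{k₀}^{n}(Θ(A)·W)(c)·Ū_{k₀}^{n}(W)(c)⁻¹)`, lit ✓`T4AvgSensitivity.iterFrom`) IS ✓(D2)'s iterate from level `0` of the shorter tower `F.PP (m+K−k₀) 0`, read through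
# the level identifications — hence **`‖↑((DΨ^{W}_{k₀,n}(0) X) B)‖ ≤ (1+4(d+2))·e^{c₃Σ_{i<n}α_i}·L^n·‖X‖`**, the K-UNIFORM sup row for the telescope factors `Dψ_{l−1}∘⋯∘Dψ_{j+1}` of (O2-b)

Cell `ym3-torus` (YM ladder rung R3 = continuum `SU(2)` Yang–Mills on the three-torus at fixed lattice data — a RUNG: NOT d = 4, NOT infinite volume, NOT a mass gap,
NOT Clay).  Width seat «width 12» `ym3-torus-px12` (gen 27); crux `stmt-QuantumFields-20520`, LINE g18-1 S2β, node (REG-UP)′ «the Prop-4 road» (px13 g29), binder `hDcov`, step (O2-b2)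
of my 02:41:50Z plan.  `--kind proof --supports stmt-QuantumFields-20520 --as helper`, count-neutral, DEFINITION-FREE (0 `def`, 0 `instance`, 0 `notation`, 0 `sorry`, default heartbeats).
`SU(N)`; `T3Family` members (the level-shift dictionary lit ✓`T3LevelShift`: `fieldShift h V b = V (bondShift h b)`, ✓`iterFrom_fieldShift`, ✓`loopHol_fieldShift`); ✓(D2)
`…ChartReadDerivKStepSup.norm_fderiv_chartRead_iter_apply_le_exp` (px13 g25∕g26) is the engine, used BY NAME on the shorter tower.

WHAT IS PROVED (sorry-free).  With `P₂ := F.PP (F.m + K − k₀) 0`, `h₀ : P₂.sitesPerDir 0 = (F.P K).sitesPerDir k₀`, `hₙ : P₂.sitesPerDir n = (F.P K).sitesPerDir (k₀+n)`, `W̃ := fieldShift h₀ W`: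
* §1 ★`iterFrom_apply_eq_iter_shift` (`Ū_{k₀}^{n}(V)(c) = Ū^{n}(fieldShift h₀ V)((bondShift hₙ)⁻¹ c)`), ★`fieldShift_piExpChart` (`fieldShift h₀ (Θ(A)·W) = Θ(A ∘ bondShift h₀)·W̃`),
  ★★`chartReadFrom_eq_shift` — the FUNCTION identity `Ψ^{W}_{k₀,n} = T_out ∘ Ψ^{W̃}_{n} ∘ T_in` with the pre-composition maps `T_in A := A ∘ bondShift h₀`, `T_out Y := Y ∘ (bondShift hₙ)⁻¹`.
* §2 ★`smallBelow_shift_of_loopGuard` — the loop `α`-guards of the tower `Ū_{k₀}^{i} W` (`i < n`, `α_i < δ_N`) give `SmallBelow … n W̃` on the shorter tower.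
* §3 ★★`fderiv_chartReadFrom_eq` — `fderiv ℝ Ψ^{W}_{k₀,n} 0 = T_out ∘L fderiv ℝ Ψ^{W̃}_{n} 0 ∘L T_in` (chain rule at `0`, ✓`contDiffAt_chartRead_iter`);
  ★★★**`norm_fderiv_chartReadFrom_apply_le_exp`** — **`‖↑((fderiv ℝ Ψ^{W}_{k₀,n} 0 X) B)‖ ≤ (1 + 4(d+2))·exp((d+2)(422 + 1616(d+2))·Σ_{i<n} α_i)·L^n·‖X‖`** under the loop guards
  `dist1 (loopHol (Ū_{k₀}^{i} W) c idx) ≤ α_i` (`i < n`), `0 ≤ α_i ≤ 1∕24`, `α_i < δ_N`, and `k₀ + n ≤ m + K`.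
USE ((O2-b3) `hDcov_of_letters`): the telescope `DΨ_l^{U} − DΨ_l^{U′} = Σ_j (Dψ_{l−1}∘⋯∘Dψ_{j+1})∘(Dψ^{U}_j − Dψ^{U′}_j)∘DΨ^{U′}_j` has its left factors bounded by THIS FILE at `W := Ū^{j+1}U`
(`Ū_{j+1}^{i}(Ū^{j+1}U) = Ū^{j+1+i}U`, lit ✓`iter_add`), its middle factor by ✓(O2-b1) `…ChartReadDerivBkgLipschitz`, its right factor by ✓(D2).

HONEST SCOPE.  Level-shift plumbing + the chain rule at `0` over landed engines; NO estimate of Bałaban's renormalisation analysis is asserted or proved beyond what ✓(D2) carries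
([Balaban1985Averaging] Prop. 4 (127)–(130), (139)–(147) pp.37–40; [Balaban1987RG1] (0.2)∕(0.4)∕(0.11) pp.252–253: the towers and their identification); the identification of the fderiv of
`Ψ_{k₀,n}` with the composite of one-step derivatives (chain rule from level `k₀`), (O2-b3), `hDcov`, (REG-UP)′, GAP♯∘ (`stub_uniformFibreGapOrbit`, registry 3732b7df UNTOUCHED, 0∕5), the five
registered stubs, S2β, crux 20520, 19936, 19200, `YM3TorusSU2` — NOT proved; no registered stub is closed; rung R3 — NOT d = 4, NOT infinite volume, NOT a mass gap, NOT Clay; the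
Yang–Mills mass gap is NOT proved.
-/

set_option autoImplicit false

noncomputable section

open scoped Matrix.Norms.L2Operator Topology
open Filter Set Function

namespace Summit.QuantumFields.YangMills.Theorems.FluctuationComparisonRegPrIntLS2BetaChartReadIterFromSup

open Literature.MathematicalPhysics.QuantumFieldTheory.Balaban1983to89
open Literature.MathematicalPhysics.QuantumFieldTheory.Balaban1983to89.HaarExponentialChart
open Literature.MathematicalPhysics.QuantumFieldTheory.Balaban1983to89.HaarExponentialChart.IsChartRep
open Literature.MathematicalPhysics.QuantumFieldTheory.Balaban1983to89.BlockAveraging (Small Idx avgFun loopHol blockAvg blockAvg_avg)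
open Literature.MathematicalPhysics.QuantumFieldTheory.Balaban1983to89.ExpMeanLog (expMeanLogSU deltaSU)
open Literature.MathematicalPhysics.QuantumFieldTheory.Balaban1983to89.Node00
open Literature.MathematicalPhysics.QuantumFieldTheory.Balaban1983to89.T3ContinuumYM3Torus
open Literature.MathematicalPhysics.QuantumFieldTheory.Balaban1983to89.T3LevelShift
open Literature.MathematicalPhysics.QuantumFieldTheory.Balaban1983to89.T4AvgSensitivity (iterFrom)
open Summit.QuantumFields.YangMills.BalabanUVNodes.N09ChartReadAveragingSmooth
open Summit.QuantumFields.YangMills.Theorems.FluctuationComparisonRegPrIntLS2BetaChartReadDescentOnto (contDiffAt_chartRead_iter)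
open Summit.QuantumFields.YangMills.Theorems.FluctuationComparisonRegPrIntLS2BetaChartReadDerivKStepSup (norm_fderiv_chartRead_iter_apply_le_exp)

variable {N : ℕ} [NeZero N] (F : T3Family)

/-! ## §1 The iterate from level `k₀` is the iterate of the shorter tower -/

/-- ★ **`Ū_{k₀}^{n}(V)(c) = Ū^{n}(fieldShift h₀ V)((bondShift hₙ)⁻¹ c)`** (lit ✓`iterFrom_fieldShift`, read pointwise). [cite: Balaban1987RG1, (0.11) p.253] -/
theorem iterFrom_apply_eq_iter_shift {G : Type*} [GaugeGroup G] (ℰ : LoopAverage G) {K k₀ : ℕ} (hk : k₀ ≤ F.m + K) (n : ℕ)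
    (V : GaugeField (F.P K) k₀ G) (c : PBond (F.P K) (k₀ + n)) :
    iterFrom (fun i => blockAvg (P := F.P K) (j := i) ℰ) k₀ n V c =
      Averaging.iter (fun i => blockAvg (P := F.PP (F.m + K - k₀) 0) (j := i) ℰ) n
          (fieldShift (F.sitesPerDir_eq (m := F.m + K - k₀) (K := 0) (j := 0) (m' := F.m) (K' := K) (j' := k₀) (by omega)) V)
        ((bondShift (F.sitesPerDir_eq (m := F.m + K - k₀) (K := 0) (j := n) (m' := F.m) (K' := K) (j' := k₀ + n) (by omega))).symm c) := by
  have h := iterFrom_fieldShift (F := F) ℰ (m := F.m) (K := K) (m₂ := F.m + K - k₀) (K₂ := 0) (k₀ := k₀) (by omega) n V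
  have e := congrFun h ((bondShift (F.sitesPerDir_eq (m := F.m + K - k₀) (K := 0) (j := n) (m' := F.m) (K' := K) (j' := k₀ + n) (by omega))).symm c)
  rw [fieldShift_apply, Equiv.apply_symm_apply] at e
  exact e

/-- ★ The level identification commutes with the chart perturbation: `fieldShift h₀ (Θ(A)·W) = Θ(A ∘ bondShift h₀)·(fieldShift h₀ W)`. [cite: Balaban1987RG1, (0.2) p.252] -/
theorem fieldShift_piExpChart {K k₀ : ℕ} (hk : k₀ ≤ F.m + K) (W : GaugeField (F.P K) k₀ (SU N)) (A : PBond (F.P K) k₀ → (specialUnitaryLogChart (Fin N)).lie) :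
    fieldShift (F.sitesPerDir_eq (m := F.m + K - k₀) (K := 0) (j := 0) (m' := F.m) (K' := K) (j' := k₀) (by omega))
        (fun b : PBond (F.P K) k₀ => (isChartRep_specialUnitaryGroup (n := Fin N)).expChart (A b) * W b) =
      fun b : PBond (F.PP (F.m + K - k₀) 0) 0 =>
        (isChartRep_specialUnitaryGroup (n := Fin N)).expChart
            ((fun ℓ => A (bondShift (F.sitesPerDir_eq (m := F.m + K - k₀) (K := 0) (j := 0) (m' := F.m) (K' := K) (j' := k₀) (by omega)) ℓ)) b) *
          fieldShift (F.sitesPerDir_eq (m := F.m + K - k₀) (K := 0) (j := 0) (m' := F.m) (K' := K) (j' := k₀) (by omega)) W b := by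
  funext b
  simp only [fieldShift_apply]

/-- ★★ **THE FUNCTION IDENTITY**: `Ψ^{W}_{k₀,n} = T_out ∘ Ψ^{W̃}_{n} ∘ T_in` (exact, no guard). [cite: Balaban1987RG1, (0.2), (0.11) pp.252-253] -/
theorem chartReadFrom_eq_shift {K k₀ n : ℕ} (hk : k₀ + n ≤ F.m + K) (W : GaugeField (F.P K) k₀ (SU N))
    (A : PBond (F.P K) k₀ → (specialUnitaryLogChart (Fin N)).lie) (c : PBond (F.P K) (k₀ + n)) :
    (isChartRep_specialUnitaryGroup (n := Fin N)).logChart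
        (iterFrom (fun i => blockAvg (P := F.P K) (j := i) (expMeanLogSU (n := Fin N))) k₀ n
            (fun b : PBond (F.P K) k₀ => (isChartRep_specialUnitaryGroup (n := Fin N)).expChart (A b) * W b) c *
          (iterFrom (fun i => blockAvg (P := F.P K) (j := i) (expMeanLogSU (n := Fin N))) k₀ n W c)⁻¹) =
      (isChartRep_specialUnitaryGroup (n := Fin N)).logChart
        (Averaging.iter (fun i => blockAvg (P := F.PP (F.m + K - k₀) 0) (j := i) (expMeanLogSU (n := Fin N))) n
            (fun b => (isChartRep_specialUnitaryGroup (n := Fin N)).expChart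
                ((fun ℓ => A (bondShift (F.sitesPerDir_eq (m := F.m + K - k₀) (K := 0) (j := 0) (m' := F.m) (K' := K) (j' := k₀) (by omega)) ℓ)) b) *
              fieldShift (F.sitesPerDir_eq (m := F.m + K - k₀) (K := 0) (j := 0) (m' := F.m) (K' := K) (j' := k₀) (by omega)) W b)
            ((bondShift (F.sitesPerDir_eq (m := F.m + K - k₀) (K := 0) (j := n) (m' := F.m) (K' := K) (j' := k₀ + n) (by omega))).symm c) *
          (Averaging.iter (fun i => blockAvg (P := F.PP (F.m + K - k₀) 0) (j := i) (expMeanLogSU (n := Fin N))) n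
              (fieldShift (F.sitesPerDir_eq (m := F.m + K - k₀) (K := 0) (j := 0) (m' := F.m) (K' := K) (j' := k₀) (by omega)) W)
            ((bondShift (F.sitesPerDir_eq (m := F.m + K - k₀) (K := 0) (j := n) (m' := F.m) (K' := K) (j' := k₀ + n) (by omega))).symm c))⁻¹) := by
  rw [iterFrom_apply_eq_iter_shift F (expMeanLogSU (n := Fin N)) (by omega) n _ c, iterFrom_apply_eq_iter_shift F (expMeanLogSU (n := Fin N)) (by omega) n W c,
    fieldShift_piExpChart F (by omega) W A]

/-! ## §2 The guards transport -/

/-- ★ The loop `α`-guards of `Ū_{k₀}^{i} W` (`i < n`, `α_i < δ_N`) give the (0.4) guard below `n` for `W̃` on the shorter tower (lit ✓`iterFrom_fieldShift`, ✓`loopHol_fieldShift`).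
[cite: Balaban1987RG1, (0.4), (0.11) p.253] -/
theorem smallBelow_shift_of_loopGuard {K k₀ n : ℕ} (hk : k₀ + n ≤ F.m + K) (W : GaugeField (F.P K) k₀ (SU N)) {α : ℕ → ℝ}
    (hαδ : ∀ i, α i < deltaSU (Fin N))
    (hα : ∀ i, i < n → ∀ (c : PBond (F.P K) (k₀ + i + 1)) (idx : Idx (F.P K)),
      dist1 (loopHol (iterFrom (fun i => blockAvg (P := F.P K) (j := i) (expMeanLogSU (n := Fin N))) k₀ i W) c idx) ≤ α i) :
    SmallBelow (fun i => blockAvg (P := F.PP (F.m + K - k₀) 0) (j := i) (expMeanLogSU (n := Fin N))) n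
      (fieldShift (F.sitesPerDir_eq (m := F.m + K - k₀) (K := 0) (j := 0) (m' := F.m) (K' := K) (j' := k₀) (by omega)) W) := by
  intro i hi c idx
  have h := iterFrom_fieldShift (F := F) (expMeanLogSU (n := Fin N)) (m := F.m) (K := K) (m₂ := F.m + K - k₀) (K₂ := 0) (k₀ := k₀) (by omega) i W
  rw [← h, loopHol_fieldShift (F.sitesPerDir_eq (m := F.m + K - k₀) (K := 0) (j := i) (m' := F.m) (K' := K) (j' := k₀ + i) (by omega))
    (F.sitesPerDir_eq (m := F.m + K - k₀) (K := 0) (j := i + 1) (m' := F.m) (K' := K) (j' := k₀ + i + 1) (by omega))]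
  exact lt_of_le_of_lt (hα i hi _ idx) (hαδ i)

/-! ## §3 The derivative and the sup row -/

/-- ★★ **THE OPERATOR IDENTITY**: `fderiv ℝ Ψ^{W}_{k₀,n} 0 = T_out ∘L fderiv ℝ Ψ^{W̃}_{n} 0 ∘L T_in` under the loop guards (chain rule at `0`). [cite: Balaban1987RG1, (0.11) p.253; Balaban1985Averaging, Prop. 4 (127) p.37] -/
theorem fderiv_chartReadFrom_eq {K k₀ n : ℕ} (hk : k₀ + n ≤ F.m + K) (W : GaugeField (F.P K) k₀ (SU N)) {α : ℕ → ℝ}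
    (hαδ : ∀ i, α i < deltaSU (Fin N))
    (hα : ∀ i, i < n → ∀ (c : PBond (F.P K) (k₀ + i + 1)) (idx : Idx (F.P K)),
      dist1 (loopHol (iterFrom (fun i => blockAvg (P := F.P K) (j := i) (expMeanLogSU (n := Fin N))) k₀ i W) c idx) ≤ α i) :
    fderiv ℝ (fun (A : PBond (F.P K) k₀ → (specialUnitaryLogChart (Fin N)).lie) (c : PBond (F.P K) (k₀ + n)) =>
        (isChartRep_specialUnitaryGroup (n := Fin N)).logChart
          (iterFrom (fun i => blockAvg (P := F.P K) (j := i) (expMeanLogSU (n := Fin N))) k₀ n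
              (fun b : PBond (F.P K) k₀ => (isChartRep_specialUnitaryGroup (n := Fin N)).expChart (A b) * W b) c *
            (iterFrom (fun i => blockAvg (P := F.P K) (j := i) (expMeanLogSU (n := Fin N))) k₀ n W c)⁻¹)) 0 =
      (ContinuousLinearMap.pi fun (c : PBond (F.P K) (k₀ + n)) =>
          ContinuousLinearMap.proj (R := ℝ) (φ := fun _ : PBond (F.PP (F.m + K - k₀) 0) n => (specialUnitaryLogChart (Fin N)).lie)
            ((bondShift (F.sitesPerDir_eq (m := F.m + K - k₀) (K := 0) (j := n) (m' := F.m) (K' := K) (j' := k₀ + n) (by omega))).symm c)).comp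
        ((fderiv ℝ (fun (A : PBond (F.PP (F.m + K - k₀) 0) 0 → (specialUnitaryLogChart (Fin N)).lie) (c : PBond (F.PP (F.m + K - k₀) 0) n) =>
            (isChartRep_specialUnitaryGroup (n := Fin N)).logChart
              (Averaging.iter (fun i => blockAvg (P := F.PP (F.m + K - k₀) 0) (j := i) (expMeanLogSU (n := Fin N))) n
                  (fun b => (isChartRep_specialUnitaryGroup (n := Fin N)).expChart (A b) *
                    fieldShift (F.sitesPerDir_eq (m := F.m + K - k₀) (K := 0) (j := 0) (m' := F.m) (K' := K) (j' := k₀) (by omega)) W b) c *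
                (Averaging.iter (fun i => blockAvg (P := F.PP (F.m + K - k₀) 0) (j := i) (expMeanLogSU (n := Fin N))) n
                  (fieldShift (F.sitesPerDir_eq (m := F.m + K - k₀) (K := 0) (j := 0) (m' := F.m) (K' := K) (j' := k₀) (by omega)) W) c)⁻¹)) 0).comp
          (ContinuousLinearMap.pi fun (ℓ : PBond (F.PP (F.m + K - k₀) 0) 0) =>
            ContinuousLinearMap.proj (R := ℝ) (φ := fun _ : PBond (F.P K) k₀ => (specialUnitaryLogChart (Fin N)).lie)
              (bondShift (F.sitesPerDir_eq (m := F.m + K - k₀) (K := 0) (j := 0) (m' := F.m) (K' := K) (j' := k₀) (by omega)) ℓ))) := by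
  set Wt := fieldShift (F.sitesPerDir_eq (m := F.m + K - k₀) (K := 0) (j := 0) (m' := F.m) (K' := K) (j' := k₀) (by omega)) W with hWt
  set Ψ := fun (A : PBond (F.PP (F.m + K - k₀) 0) 0 → (specialUnitaryLogChart (Fin N)).lie) (c : PBond (F.PP (F.m + K - k₀) 0) n) =>
      (isChartRep_specialUnitaryGroup (n := Fin N)).logChart
        (Averaging.iter (fun i => blockAvg (P := F.PP (F.m + K - k₀) 0) (j := i) (expMeanLogSU (n := Fin N))) n
            (fun b => (isChartRep_specialUnitaryGroup (n := Fin N)).expChart (A b) * Wt b) c *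
          (Averaging.iter (fun i => blockAvg (P := F.PP (F.m + K - k₀) 0) (j := i) (expMeanLogSU (n := Fin N))) n Wt c)⁻¹) with hΨ
  set Tin : (PBond (F.P K) k₀ → (specialUnitaryLogChart (Fin N)).lie) →L[ℝ] (PBond (F.PP (F.m + K - k₀) 0) 0 → (specialUnitaryLogChart (Fin N)).lie) :=
    ContinuousLinearMap.pi fun (ℓ : PBond (F.PP (F.m + K - k₀) 0) 0) =>
      ContinuousLinearMap.proj (R := ℝ) (φ := fun _ : PBond (F.P K) k₀ => (specialUnitaryLogChart (Fin N)).lie)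
        (bondShift (F.sitesPerDir_eq (m := F.m + K - k₀) (K := 0) (j := 0) (m' := F.m) (K' := K) (j' := k₀) (by omega)) ℓ) with hTin
  set Tout : (PBond (F.PP (F.m + K - k₀) 0) n → (specialUnitaryLogChart (Fin N)).lie) →L[ℝ] (PBond (F.P K) (k₀ + n) → (specialUnitaryLogChart (Fin N)).lie) :=
    ContinuousLinearMap.pi fun (c : PBond (F.P K) (k₀ + n)) =>
      ContinuousLinearMap.proj (R := ℝ) (φ := fun _ : PBond (F.PP (F.m + K - k₀) 0) n => (specialUnitaryLogChart (Fin N)).lie)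
        ((bondShift (F.sitesPerDir_eq (m := F.m + K - k₀) (K := 0) (j := n) (m' := F.m) (K' := K) (j' := k₀ + n) (by omega))).symm c) with hTout
  have hfun : (fun (A : PBond (F.P K) k₀ → (specialUnitaryLogChart (Fin N)).lie) (c : PBond (F.P K) (k₀ + n)) =>
        (isChartRep_specialUnitaryGroup (n := Fin N)).logChart
          (iterFrom (fun i => blockAvg (P := F.P K) (j := i) (expMeanLogSU (n := Fin N))) k₀ n
              (fun b : PBond (F.P K) k₀ => (isChartRep_specialUnitaryGroup (n := Fin N)).expChart (A b) * W b) c *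
            (iterFrom (fun i => blockAvg (P := F.P K) (j := i) (expMeanLogSU (n := Fin N))) k₀ n W c)⁻¹)) =
      (⇑Tout ∘ (Ψ ∘ ⇑Tin)) := by
    funext A
    funext c
    rw [chartReadFrom_eq_shift F hk W A c]
    simp only [Function.comp_apply, hTout, hTin, hΨ, hWt, ContinuousLinearMap.pi_apply, ContinuousLinearMap.proj_apply]
  rw [hfun]
  have hT0 : Tin 0 = 0 := map_zero Tin
  have hsb := smallBelow_shift_of_loopGuard F hk W hαδ hα
  have hΨD : DifferentiableAt ℝ Ψ (Tin 0) := by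
    rw [hT0]
    exact (contDiffAt_chartRead_iter (P := F.PP (F.m + K - k₀) 0) (N := N) Wt n hsb).differentiableAt (by simp)
  have h1 : HasFDerivAt (Ψ ∘ ⇑Tin) ((fderiv ℝ Ψ (Tin 0)).comp Tin) 0 :=
    HasFDerivAt.comp (𝕜 := ℝ) (f := ⇑Tin) (f' := Tin) (g := Ψ) (g' := fderiv ℝ Ψ (Tin 0))
      (0 : PBond (F.P K) k₀ → (specialUnitaryLogChart (Fin N)).lie) hΨD.hasFDerivAt Tin.hasFDerivAt
  have h2 : HasFDerivAt (⇑Tout ∘ (Ψ ∘ ⇑Tin)) (Tout.comp ((fderiv ℝ Ψ (Tin 0)).comp Tin)) 0 :=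
    HasFDerivAt.comp (𝕜 := ℝ) (f := Ψ ∘ ⇑Tin) (f' := (fderiv ℝ Ψ (Tin 0)).comp Tin) (g := ⇑Tout) (g' := Tout)
      (0 : PBond (F.P K) k₀ → (specialUnitaryLogChart (Fin N)).lie) Tout.hasFDerivAt h1
  rw [h2.fderiv, hT0]

/-- ★★★ **THE k-STEP SUP ROW FROM LEVEL `k₀`**: under the loop `α`-guards of `Ū_{k₀}^{i} W` (`i < n`; `0 ≤ α_i ≤ 1∕24`, `α_i < δ_N`) and `k₀ + n ≤ m + K`,
**`‖↑((fderiv ℝ Ψ^{W}_{k₀,n} 0 X) B)‖ ≤ (1 + 4(d+2))·exp((d+2)(422 + 1616(d+2))·Σ_{i<n} α_i)·L^n·‖X‖`** — ✓(D2) on the shorter tower, read through §3. [cite: Balaban1985Averaging, Prop. 4 (127)-(130), (139)-(147) pp.37-40; Balaban1987RG1, (0.11) p.253] -/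
theorem norm_fderiv_chartReadFrom_apply_le_exp {K k₀ n : ℕ} (hk : k₀ + n ≤ F.m + K) (W : GaugeField (F.P K) k₀ (SU N))
    (X : PBond (F.P K) k₀ → (specialUnitaryLogChart (Fin N)).lie) {α : ℕ → ℝ}
    (hα0 : ∀ i, 0 ≤ α i) (hα24 : ∀ i, α i ≤ 1 / 24) (hαδ : ∀ i, α i < deltaSU (Fin N))
    (hα : ∀ i, i < n → ∀ (c : PBond (F.P K) (k₀ + i + 1)) (idx : Idx (F.P K)),
      dist1 (loopHol (iterFrom (fun i => blockAvg (P := F.P K) (j := i) (expMeanLogSU (n := Fin N))) k₀ i W) c idx) ≤ α i)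
    (B : PBond (F.P K) (k₀ + n)) :
    ‖((fderiv ℝ (fun (A : PBond (F.P K) k₀ → (specialUnitaryLogChart (Fin N)).lie) (c : PBond (F.P K) (k₀ + n)) =>
          (isChartRep_specialUnitaryGroup (n := Fin N)).logChart
            (iterFrom (fun i => blockAvg (P := F.P K) (j := i) (expMeanLogSU (n := Fin N))) k₀ n
                (fun b : PBond (F.P K) k₀ => (isChartRep_specialUnitaryGroup (n := Fin N)).expChart (A b) * W b) c *
              (iterFrom (fun i => blockAvg (P := F.P K) (j := i) (expMeanLogSU (n := Fin N))) k₀ n W c)⁻¹)) 0 X B :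
          (specialUnitaryLogChart (Fin N)).lie) : Matrix (Fin N) (Fin N) ℂ)‖ ≤
      (1 + 4 * (((F.P K).d + 2 : ℕ) : ℝ)) * Real.exp ((((F.P K).d + 2 : ℕ) : ℝ) * (422 + 1616 * (((F.P K).d + 2 : ℕ) : ℝ)) * ∑ j ∈ Finset.range n, α j) *
        ((F.P K).L : ℝ) ^ n * ‖X‖ := by
  rw [fderiv_chartReadFrom_eq F hk W hαδ hα]
  simp only [ContinuousLinearMap.comp_apply, ContinuousLinearMap.pi_apply, ContinuousLinearMap.proj_apply]
  -- the guards of the shorter tower, in (D2)'s currency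
  have hα' : ∀ i, i < n → ∀ (c : PBond (F.PP (F.m + K - k₀) 0) (i + 1)) (idx : Idx (F.PP (F.m + K - k₀) 0)),
      dist1 (loopHol (Averaging.iter (fun i => blockAvg (P := F.PP (F.m + K - k₀) 0) (j := i) (expMeanLogSU (n := Fin N))) i
        (fieldShift (F.sitesPerDir_eq (m := F.m + K - k₀) (K := 0) (j := 0) (m' := F.m) (K' := K) (j' := k₀) (by omega)) W)) c idx) ≤ α i := by
    intro i hi c idx
    have h := iterFrom_fieldShift (F := F) (expMeanLogSU (n := Fin N)) (m := F.m) (K := K) (m₂ := F.m + K - k₀) (K₂ := 0) (k₀ := k₀) (by omega) i W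
    rw [← h, loopHol_fieldShift (F.sitesPerDir_eq (m := F.m + K - k₀) (K := 0) (j := i) (m' := F.m) (K' := K) (j' := k₀ + i) (by omega))
      (F.sitesPerDir_eq (m := F.m + K - k₀) (K := 0) (j := i + 1) (m' := F.m) (K' := K) (j' := k₀ + i + 1) (by omega))]
    exact hα i hi _ idx
  have hD2 := norm_fderiv_chartRead_iter_apply_le_exp (P := F.PP (F.m + K - k₀) 0) (N := N)
    (fieldShift (F.sitesPerDir_eq (m := F.m + K - k₀) (K := 0) (j := 0) (m' := F.m) (K' := K) (j' := k₀) (by omega)) W)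
    (fun ℓ => X (bondShift (F.sitesPerDir_eq (m := F.m + K - k₀) (K := 0) (j := 0) (m' := F.m) (K' := K) (j' := k₀) (by omega)) ℓ))
    hα0 hα24 hαδ n hα'
    ((bondShift (F.sitesPerDir_eq (m := F.m + K - k₀) (K := 0) (j := n) (m' := F.m) (K' := K) (j' := k₀ + n) (by omega))).symm B)
  -- `‖X ∘ bondShift‖ ≤ ‖X‖`
  have hXn : ‖(fun ℓ => X (bondShift (F.sitesPerDir_eq (m := F.m + K - k₀) (K := 0) (j := 0) (m' := F.m) (K' := K) (j' := k₀) (by omega)) ℓ))‖ ≤ ‖X‖ :=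
    (pi_norm_le_iff_of_nonneg (norm_nonneg _)).2 fun ℓ => norm_le_pi_norm X _
  have hC : 0 ≤ (1 + 4 * ((((F.PP (F.m + K - k₀) 0).d + 2 : ℕ) : ℝ))) *
      Real.exp (((((F.PP (F.m + K - k₀) 0).d + 2 : ℕ) : ℝ)) * (422 + 1616 * ((((F.PP (F.m + K - k₀) 0).d + 2 : ℕ) : ℝ))) * ∑ j ∈ Finset.range n, α j) *
        (((F.PP (F.m + K - k₀) 0).L : ℝ)) ^ n := by positivity
  exact hD2.trans (mul_le_mul_of_nonneg_left hXn hC)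

end Summit.QuantumFields.YangMills.Theorems.FluctuationComparisonRegPrIntLS2BetaChartReadIterFromSup

end
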